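import Literature.Probability.RandomPlanarGeometry.RestrictionMeasuresFiveEighthsProofs
import Literature.Probability.RandomPlanarGeometry.SLEKappaRhoAsymmetryLeaves
import Literature.Probability.RandomPlanarGeometry.OneSidedRestrictionHolds
import HarnessLib

/-!
# The comparison sentence of [LSW] Cor. 8.6 (`SLEKappaRho.measure_I_notMem_fill_lt_of_neg`) from the martingale of Lemmas 8.9–8.10 alone

Proof-only companion (no definition, no named fact) of `SLEKappaRhoAsymmetry`, for the named fact
`Literature.Probability.RandomPlanarGeometry.SLEKappaRho.measure_I_notMem_fill_lt_of_neg` (and its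
parent `SLEKappaRho.one_half_lt_measure_I_notMem_fill` of `SLEKappaRho`), after

* G. F. Lawler, O. Schramm, W. Werner, *Conformal restriction: the chordal case*, J. Amer. Math.
  Soc. **16** (2003) 917–955, arXiv:math/0209343 (**[LSW]**, arXiv page numbers), proof of
  Cor. 8.6 (p. 38): "Note that when `ρ < 0`, `W_t − √κ B_t` is decreasing. It follows easily
  that the probability that `i` ends up eventually to 'the right' of the right hand boundary of
  SLE(8/3, ρ) (i.e., `i` is separated from `1` by `K_∞ ∪ (−∞, 0]`), is strictly larger than the
  corresponding quantity for SLE(8/3, 0), which is `1/2` by symmetry."; Thm. 8.4 (p. 37); §8.2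
  (the sentence preceding Prop. 8.2: independent one-sided hulls compose and "the exponent add
  up"); §8.1 (p. 31, uniqueness of `P⁺_α`); §4 Prop. 4.1 (p. 16, the Brownian excursion, `P_1`).
* G. F. Lawler, *Conformally Invariant Processes in the Plane*, AMS (2005) (**[Law05]**),
  Cor. 9.11 (p. 219) with §9.2 Prop. 9.13 (p. 220): `P⁺_α{i ∉ K} = q(α)` is strictly decreasing,
  `q(5/8) = 1/2`.

No proof of the comparison is printed ("It follows easily"). The tree reads it at the level of
laws: by Thm. 8.4 the left filling `F^{ℝ₊}_ℍ(cl K_∞)` of SLE(8/3, ρ) has law `P⁺_{α(ρ)}`,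
`α(ρ) = (3ρ + 10)(2 + ρ)/32 ∈ (0, 5/8)` for `−2 < ρ < 0`, and `P⁺_α{i ∉ K} > 1/2 = P⁺_{5/8}{i ∉ K}`
for `0 < α < 5/8` (semigroup `P⁺_{5/8} = F(P⁺_α ⊗ P⁺_{5/8−α})`, with the strictness
`P⁺_β{i ∈ K} > 0` read off a left-filled Poissonian cloud of hung `P_1`-samples, [Law05]
Prop. 9.13 / Cor. 9.11). Of the two deep inputs of that reading, the existence of a two-sided
restriction measure of exponent `1` is now a THEOREM of the tree
(`exists_isRestrictionMeasure_one_brownianQuad`, file `BrownianExcursionRestriction`: [LSW]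
Prop. 4.1, the filled Brownian excursion; whence `exists_isRightRestrictionMeasure_lt_five_eighths_holds`,
file `OneSidedRestrictionHolds`), and the symmetry sentence is discharged
(`SLEKappaRho.measure_I_notMem_fill_eq_half_holds`, file `RestrictionMeasuresFiveEighthsProofs`).
This file records the consequence: **the comparison sentence and its parent now rest on the
SINGLE remaining leaf of §8.4, the one-sided restriction martingale of Lemmas 8.9–8.10**
(`SLEKappaRho.exists_isOneSidedMartingale`, file `SLEKappaRhoRestriction`, which gives Thm. 8.4 in
law form, `SLEKappaRho.isRightRestrictionMeasure_fill_of_martingale`):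

* `SLEKappaRho.one_half_lt_measure_I_notMem_fill_of_fill` — `P{i ∉ F^{ℝ₊}_ℍ(cl K_∞)} > 1/2` for
  `−2 < ρ < 0` from Thm. 8.4 in law form alone;
* `SLEKappaRho.measure_I_notMem_fill_lt_of_neg_of_fill` — the comparison sentence from Thm. 8.4
  in law form alone;
* `SLEKappaRho.one_half_lt_measure_I_notMem_fill_of_martingale`,
  `SLEKappaRho.measure_I_notMem_fill_lt_of_neg_of_martingale` — the same two facts from the
  martingale leaf alone.

So the discharges `SLEKappaRho.measure_I_notMem_fill_lt_of_neg_holds` and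
`SLEKappaRho.one_half_lt_measure_I_notMem_fill_holds` are these theorems applied to
`SLEKappaRho.exists_isOneSidedMartingale_holds`, once it exists. No new named fact is introduced.

Not here: the dynamical reading of the sentence in Schramm's coordinates
(`SLEKappaRhoSchrammObservable`, `SLESchrammMartingale`: the left-passage observable
`h(w_t)`, a bounded martingale for SLE_{8/3} and a submartingale for `ρ < 0`), whose remaining
inputs (the dichotomy `w_t → ±∞` and Schramm's Lemma 3 for the SLE(8/3, ρ) hulls) rest on the
fine structure of the SLE(8/3, ρ) trace and are not needed for the discharge above.

Mathlib: none beyond the imports. Tree: `SLEKappaRho.one_half_lt_measure_I_notMem_fill_of_fill_of_lt_five_eighths`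
(`SLEKappaRhoAsymmetryLeaves`), `exists_isRightRestrictionMeasure_lt_five_eighths_holds`
(`OneSidedRestrictionHolds`), `SLEKappaRho.measure_I_notMem_fill_lt_of_neg_of`
(`SLEKappaRhoAsymmetry`), `SLEKappaRho.measure_I_notMem_fill_eq_half_holds`,
`SLEKappaRho.isRightRestrictionMeasure_fill_of_martingale` (`RestrictionMeasuresFiveEighthsProofs`).

## References

* [LSW] proof of Cor. 8.6 (p. 38), Thm. 8.4 (p. 37), §8.1 (p. 31), §8.2, Prop. 4.1 (p. 16).
  [LawlerSchrammWerner2003Restriction]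
* [Law05] Cor. 9.11 (p. 219), §9.2 Prop. 9.13 (p. 220). [Lawler2005]
-/

noncomputable section

namespace Literature.Probability.RandomPlanarGeometry

/-! ### From [LSW] Thm. 8.4 in law form -/

/-- **`P{i ∉ F^{ℝ₊}_ℍ(cl K_∞)} > 1/2` for SLE(8/3, ρ), `−2 < ρ < 0`, from [LSW] Thm. 8.4 in law
form alone** (`SLEKappaRho.isRightRestrictionMeasure_fill`: the `Ω₊`-valued version of
`F^{ℝ₊}_ℍ(cl K_∞)` has law `P⁺_{α(ρ)}`): the Cor. 8.6 input "`P⁺_α` exists and `P⁺_α{i ∉ K} > 1/2`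
for `0 < α < 5/8`" is a theorem of the tree (`exists_isRightRestrictionMeasure_lt_five_eighths_holds`,
from the filled Brownian excursion `P_1` of Prop. 4.1), and `0 < α(ρ) < 5/8`.
[cite: LawlerSchrammWerner2003Restriction, proof of Cor. 8.6 (p. 38) with Thm. 8.4 (p. 37), §8.1–8.2 and Prop. 4.1 (p. 16)] -/
theorem SLEKappaRho.one_half_lt_measure_I_notMem_fill_of_fill
    (h84 : SLEKappaRho.isRightRestrictionMeasure_fill) :
    SLEKappaRho.one_half_lt_measure_I_notMem_fill :=
  SLEKappaRho.one_half_lt_measure_I_notMem_fill_of_fill_of_lt_five_eighths h84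
    exists_isRightRestrictionMeasure_lt_five_eighths_holds

/-- **The comparison sentence of p. 38 from [LSW] Thm. 8.4 in law form alone**: for `−2 < ρ < 0`,
every SLE(8/3, ρ) driving pair and every SLE(8/3, 0) driving pair,
`P{i ∉ F^{ℝ₊}_ℍ(cl K_∞(W₀))} < P{i ∉ F^{ℝ₊}_ℍ(cl K_∞(W))}` — the left side is `1/2` (the symmetry
sentence, `SLEKappaRho.measure_I_notMem_fill_eq_half_holds`), the right side is `> 1/2`
(`SLEKappaRho.one_half_lt_measure_I_notMem_fill_of_fill`).
[cite: LawlerSchrammWerner2003Restriction, proof of Cor. 8.6 (p. 38), first two sentences, with Thm. 8.4 (p. 37)] -/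
theorem SLEKappaRho.measure_I_notMem_fill_lt_of_neg_of_fill
    (h84 : SLEKappaRho.isRightRestrictionMeasure_fill) :
    SLEKappaRho.measure_I_notMem_fill_lt_of_neg :=
  SLEKappaRho.measure_I_notMem_fill_lt_of_neg_of SLEKappaRho.measure_I_notMem_fill_eq_half_holds
    (SLEKappaRho.one_half_lt_measure_I_notMem_fill_of_fill h84)

/-! ### From the one-sided restriction martingale of Lemmas 8.9–8.10 -/

/-- **`P{i ∉ F^{ℝ₊}_ℍ(cl K_∞)} > 1/2` for SLE(8/3, ρ), `−2 < ρ < 0`, from the martingale of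
[LSW] Lemmas 8.9–8.10 alone** (`SLEKappaRho.exists_isOneSidedMartingale`, which gives Thm. 8.4 in
law form, `SLEKappaRho.isRightRestrictionMeasure_fill_of_martingale`). The discharge
`SLEKappaRho.one_half_lt_measure_I_notMem_fill_holds` is this theorem applied to
`SLEKappaRho.exists_isOneSidedMartingale_holds`, once it exists.
[cite: LawlerSchrammWerner2003Restriction, proof of Cor. 8.6 (p. 38) with Thm. 8.4 (p. 37) and Lemmas 8.9–8.10 (§8.4)] -/
theorem SLEKappaRho.one_half_lt_measure_I_notMem_fill_of_martingale
    (hM : SLEKappaRho.exists_isOneSidedMartingale) :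
    SLEKappaRho.one_half_lt_measure_I_notMem_fill :=
  SLEKappaRho.one_half_lt_measure_I_notMem_fill_of_fill
    (SLEKappaRho.isRightRestrictionMeasure_fill_of_martingale hM)

/-- **The comparison sentence of p. 38 from the martingale of [LSW] Lemmas 8.9–8.10 alone.** The
discharge `SLEKappaRho.measure_I_notMem_fill_lt_of_neg_holds` is this theorem applied to
`SLEKappaRho.exists_isOneSidedMartingale_holds`, once it exists.
[cite: LawlerSchrammWerner2003Restriction, proof of Cor. 8.6 (p. 38), first two sentences, with Thm. 8.4 (p. 37) and Lemmas 8.9–8.10 (§8.4)] -/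
theorem SLEKappaRho.measure_I_notMem_fill_lt_of_neg_of_martingale
    (hM : SLEKappaRho.exists_isOneSidedMartingale) :
    SLEKappaRho.measure_I_notMem_fill_lt_of_neg :=
  SLEKappaRho.measure_I_notMem_fill_lt_of_neg_of_fill
    (SLEKappaRho.isRightRestrictionMeasure_fill_of_martingale hM)

end Literature.Probability.RandomPlanarGeometry

end
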